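import Mathlib
import Literature.Topology.FourManifolds.PlanarAchiralWords
import Literature.Topology.FourManifolds.PlanarShadowWalk
import Summits.SmoothPoincare4.SmoothPoincare4.Theorems.ConvexBisectionPlanarAcyclicBisectionRigidityHelperWalkThreeClassify
import HarnessLib

/-!
# Crux `ConvexBisection.PlanarAcyclicBisectionRigidity`, line Sketch v3.0 — `stub_walk3`, part 3b:
# the degenerate (commuting) configurations and global conjugation by a half-twist

Part 3a classified letters on three holes.  Here: (i) a block with two CENTRAL letters is sorted by
central moves alone (`stepL` / `stepR` / `stepLneg`), and two such blocks with matching central twists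
walk to an honest double (`Walk3.degenerate`: the single remaining twists agree by cancellation of the
commuting central twists in the equal monodromies); (ii) the effect of a global conjugation
`Move.conj [σ]` on letters: ranges, hole types (permuted), central letters (central again), and the
block form (`Walk3.conj_reach`, registered as `helper_walk3_conjReach`).  Part 3c dispatches the
generic configurations to `Walk3.generic_xy` (part 2) and assembles `stub_walk3` from the three
registered analytic helpers.
-/

noncomputable section

open Literature.Topology.FourManifolds Literature.Topology.FourManifolds.PlanarWords
open Literature.Topology.FourManifolds.PlanarShadow (F₂ gx gy IsXYGen shadowWord shadowWord_append
  shadowWord_nil XYPairs)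

-- the prescribed namespace `Summit.<S>.<P>.…` repeats `SmoothPoincare4` (S = P = SmoothPoincare4)
set_option linter.dupNamespace false

namespace Summit.SmoothPoincare4.SmoothPoincare4.Theorems.PlanarAcyclicBisectionRigidity.Sketch

namespace Walk3

open ArcData PGen WalkLow SeamNG ReachMon Conj3

set_option quotPrecheck false in
/-- `Central[d]`: the positive twist of `d` is `T_[j,j]` for some `j` or `T_[0,2]`. [folklore] -/
local notation "Central[" d "]" => ((∃ j : Fin 3, T 3 (d, true) = U 3 [PGen.round j.val j.val false]) ∨
  T 3 (d, true) = U 3 [PGen.round 0 2 false])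

set_option quotPrecheck false in
/-- `XYData[c, p]`: the positive twist of `c` evaluates like an XY-word of shadow `p`. [folklore] -/
local notation "XYData[" c ", " p "]" => (∃ g : List PGen, (∀ q ∈ g, IsXYGen q) ∧ shadowWord g = p ∧
  evalWord 3 (PlanarCurve.twistWord c true) = evalWord 3 g)

set_option quotPrecheck false in
/-- `KindX[c]`: `c` has hole type `110` and `x`-data. [folklore] -/
local notation "KindX[" c "]" => (AbArc.typeVec 3 c = ![1, 1, 0] ∧
  ∃ p : F₂, XYData[c, p] ∧ ∃ u : F₂, p = u * gx * u⁻¹)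

set_option quotPrecheck false in
/-- `KindY[c]`: `c` has hole type `011` and `y`-data. [folklore] -/
local notation "KindY[" c "]" => (AbArc.typeVec 3 c = ![0, 1, 1] ∧
  ∃ p : F₂, XYData[c, p] ∧ ∃ u : F₂, p = u * gy * u⁻¹)

set_option quotPrecheck false in
/-- `KindZ[c]`: `c` has hole type `101`. [folklore] -/
local notation "KindZ[" c "]" => (AbArc.typeVec 3 c = ![1, 0, 1])

/-! ## Moving one letter of a block to the end (central moves of the others) -/

/-- One central positive letter `d` steps left past `x` (twist, range kept; `x` untouched).
[folklore] -/
theorem stepL (pre post : List Letter) (x d : PlanarCurve) (hd : Central[d]) (hx : x.InRange 3)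
    (hdr : d.InRange 3) :
    ∃ d' : PlanarCurve, T 3 (d', true) = T 3 (d, true) ∧ d'.InRange 3 ∧
      Reachable (3, pre ++ (x, true) :: (d, true) :: post) (3, pre ++ (d', true) :: (x, true) :: post) := by
  obtain ⟨d', h2, hT, hr, hreach⟩ := move_central_left pre post (x, true) (d, true) hd hx hdr
  obtain ⟨dc, ds⟩ := d'
  simp only at h2 hT hr
  subst h2
  exact ⟨dc, hT, hr, hreach⟩

/-- One central negative letter `d` steps right past `x` (twist, range kept; `x` untouched).
[folklore] -/
theorem stepR (pre post : List Letter) (d x : PlanarCurve) (hd : Central[d]) (hx : x.InRange 3)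
    (hdr : d.InRange 3) :
    ∃ d' : PlanarCurve, T 3 (d', true) = T 3 (d, true) ∧ d'.InRange 3 ∧
      Reachable (3, pre ++ (d, false) :: (x, false) :: post) (3, pre ++ (x, false) :: (d', false) :: post) := by
  obtain ⟨d', h2, hT, hr, hreach⟩ := move_central_right pre post (d, false) (x, false) hd hx hdr
  obtain ⟨dc, ds⟩ := d'
  simp only at h2 hT hr
  subst h2
  exact ⟨dc, hT, hr, hreach⟩

/-- One central negative letter `d` steps left past `x` (twist, range kept; `x` untouched).
[folklore] -/
theorem stepLneg (pre post : List Letter) (x d : PlanarCurve) (hd : Central[d]) (hx : x.InRange 3)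
    (hdr : d.InRange 3) :
    ∃ d' : PlanarCurve, T 3 (d', true) = T 3 (d, true) ∧ d'.InRange 3 ∧
      Reachable (3, pre ++ (x, false) :: (d, false) :: post) (3, pre ++ (d', false) :: (x, false) :: post) := by
  obtain ⟨d', h2, hT, hr, hreach⟩ := move_central_left pre post (x, false) (d, false) hd hx hdr
  obtain ⟨dc, ds⟩ := d'
  simp only at h2 hT hr
  subst h2
  exact ⟨dc, hT, hr, hreach⟩

/-- **Degenerate normalisation of the positive block**: with `u`, `v` central, the block `{u, v, κ}`
in any order walks to `[u′, v′, κ]` (`κ` untouched; `u′`, `v′` respellings with the same twists).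
[folklore] -/
theorem degen_pos {L : List PlanarCurve} {u v κ : PlanarCurve}
    (hL : L = [u, v, κ] ∨ L = [u, κ, v] ∨ L = [v, u, κ] ∨ L = [κ, u, v] ∨ L = [v, κ, u] ∨ L = [κ, v, u])
    (hu : Central[u]) (hv : Central[v]) (hur : u.InRange 3) (hvr : v.InRange 3) (hκr : κ.InRange 3)
    (tail : List Letter) :
    ∃ u' v' : PlanarCurve, T 3 (u', true) = T 3 (u, true) ∧ T 3 (v', true) = T 3 (v, true) ∧
      u'.InRange 3 ∧ v'.InRange 3 ∧
      Reachable (3, positiveWord L ++ tail) (3, positiveWord [u', v', κ] ++ tail) := by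
  -- `[κ, u, v] → [u′, κ, v] → [u′, v′, κ]`
  have caseK : ∀ (u v : PlanarCurve), Central[u] → Central[v] → u.InRange 3 → v.InRange 3 →
      ∃ u' v' : PlanarCurve, T 3 (u', true) = T 3 (u, true) ∧ T 3 (v', true) = T 3 (v, true) ∧
        u'.InRange 3 ∧ v'.InRange 3 ∧
        Reachable (3, positiveWord [κ, u, v] ++ tail) (3, positiveWord [u', v', κ] ++ tail) := by
    intro u v hu hv hur hvr
    obtain ⟨u', hTu, hu'r, h₁⟩ := stepL [] ((v, true) :: tail) κ u hu hκr hur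
    have hv' : Central[v] := hv
    obtain ⟨v', hTv, hv'r, h₂⟩ := stepL [(u', true)] tail κ v hv hκr hvr
    exact ⟨u', v', hTu, hTv, hu'r, hv'r, WalkLevel3.reach_trans h₁ h₂⟩
  rcases hL with rfl | rfl | rfl | rfl | rfl | rfl
  · exact ⟨u, v, rfl, rfl, hur, hvr, Reachable.refl _⟩
  · -- `[u, κ, v] → [u, v′, κ]`
    obtain ⟨v', hTv, hv'r, h⟩ := stepL [(u, true)] tail κ v hv hκr hvr
    exact ⟨u, v', rfl, hTv, hur, hv'r, h⟩
  · -- `[v, u, κ] → [u′, v, κ]`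
    obtain ⟨u', hTu, hu'r, h⟩ := stepL [] ((κ, true) :: tail) v u hu hvr hur
    exact ⟨u', v, hTu, rfl, hu'r, hvr, h⟩
  · exact caseK u v hu hv hur hvr
  · -- `[v, κ, u] → [v, u′, κ] → [u″, v, κ]`
    obtain ⟨u', hTu, hu'r, h₁⟩ := stepL [(v, true)] tail κ u hu hκr hur
    have hu' : Central[u'] := by rw [hTu]; exact hu
    obtain ⟨u'', hTu', hu''r, h₂⟩ := stepL [] ((κ, true) :: tail) v u' hu' hvr hu'r
    exact ⟨u'', v, hTu'.trans hTu, rfl, hu''r, hvr, WalkLevel3.reach_trans h₁ h₂⟩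
  · -- `[κ, v, u] → [κ, u′, v] → caseK`
    obtain ⟨u', hTu, hu'r, h₁⟩ := stepL [(κ, true)] tail v u hu hvr hur
    have hu' : Central[u'] := by rw [hTu]; exact hu
    obtain ⟨u'', v', hTu', hTv, hu''r, hv'r, h₂⟩ := caseK u' v hu' hv hu'r hvr
    exact ⟨u'', v', hTu'.trans hTu, hTv, hu''r, hv'r, WalkLevel3.reach_trans h₁ h₂⟩

/-- **Degenerate normalisation of the negative block**: with `u`, `v` central, the negative block
`{u, v, κ}` in any order walks to the block form of `[u′, v′, κ]`, i.e. the tail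
`[(κ,ff), (v′,ff), (u′,ff)]` (`κ` untouched). [folklore] -/
theorem degen_neg (A : List PlanarCurve) {B : List PlanarCurve} {u v κ : PlanarCurve}
    (hB : B = [u, v, κ] ∨ B = [u, κ, v] ∨ B = [v, u, κ] ∨ B = [κ, u, v] ∨ B = [v, κ, u] ∨ B = [κ, v, u])
    (hu : Central[u]) (hv : Central[v]) (hur : u.InRange 3) (hvr : v.InRange 3) (hκr : κ.InRange 3) :
    ∃ u' v' : PlanarCurve, T 3 (u', true) = T 3 (u, true) ∧ T 3 (v', true) = T 3 (v, true) ∧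
      u'.InRange 3 ∧ v'.InRange 3 ∧
      Reachable (3, blockForm A B) (3, blockForm A [u', v', κ]) := by
  -- tails: `blockForm A [b₁,b₂,b₃] = positiveWord A ++ [(b₃,ff),(b₂,ff),(b₁,ff)]`; target tail `[(κ,ff),(v′,ff),(u′,ff)]`
  have caseK : ∀ (u v : PlanarCurve), Central[u] → Central[v] → u.InRange 3 → v.InRange 3 →
      ∃ u' v' : PlanarCurve, T 3 (u', true) = T 3 (u, true) ∧ T 3 (v', true) = T 3 (v, true) ∧
        u'.InRange 3 ∧ v'.InRange 3 ∧
        Reachable (3, positiveWord A ++ [(v, false), (u, false), (κ, false)])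
          (3, positiveWord A ++ [(κ, false), (v', false), (u', false)]) := by
    -- `[(v,ff),(u,ff),(κ,ff)] → [(v,ff),(κ,ff),(u′,ff)] → [(κ,ff),(v′,ff),(u′,ff)]`
    intro u v hu hv hur hvr
    obtain ⟨u', hTu, hu'r, h₁⟩ := stepR (positiveWord A ++ [(v, false)]) [] u κ hu hκr hur
    obtain ⟨v', hTv, hv'r, h₂⟩ := stepR (positiveWord A) [(u', false)] v κ hv hκr hvr
    exact ⟨u', v', hTu, hTv, hu'r, hv'r,
      WalkLevel3.reach_trans (t := (3, positiveWord A ++ [(v, false), (κ, false), (u', false)]))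
        (by simpa using h₁) (by simpa using h₂)⟩
  rcases hB with rfl | rfl | rfl | rfl | rfl | rfl
  · -- tail `[(κ,ff),(v,ff),(u,ff)]`: done
    exact ⟨u, v, rfl, rfl, hur, hvr, Reachable.refl _⟩
  · -- B = [u, κ, v]: tail `[(v,ff),(κ,ff),(u,ff)]` → `[(κ,ff),(v′,ff),(u,ff)]`
    obtain ⟨v', hTv, hv'r, h⟩ := stepR (positiveWord A) [(u, false)] v κ hv hκr hvr
    refine ⟨u, v', rfl, hTv, hur, hv'r, ?_⟩
    rw [blockForm_three, blockForm_three]; simpa using h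
  · -- B = [v, u, κ]: tail `[(κ,ff),(u,ff),(v,ff)]` → `[(κ,ff),(v′,ff),(u,ff)]` (v steps left past u)
    obtain ⟨v', hTv, hv'r, h⟩ := stepLneg (positiveWord A ++ [(κ, false)]) [] u v hv hur hvr
    refine ⟨u, v', rfl, hTv, hur, hv'r, ?_⟩
    rw [blockForm_three, blockForm_three]; simpa using h
  · -- B = [κ, u, v]: tail `[(v,ff),(u,ff),(κ,ff)]`
    obtain ⟨u', v', hTu, hTv, hu'r, hv'r, h⟩ := caseK u v hu hv hur hvr
    refine ⟨u', v', hTu, hTv, hu'r, hv'r, ?_⟩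
    rw [blockForm_three, blockForm_three]; exact h
  · -- B = [v, κ, u]: tail `[(u,ff),(κ,ff),(v,ff)]` → `[(κ,ff),(u′,ff),(v,ff)]` → `[(κ,ff),(v′,ff),(u′,ff)]`
    obtain ⟨u', hTu, hu'r, h₁⟩ := stepR (positiveWord A) [(v, false)] u κ hu hκr hur
    obtain ⟨v', hTv, hv'r, h₂⟩ := stepLneg (positiveWord A ++ [(κ, false)]) [] u' v hv hu'r hvr
    refine ⟨u', v', hTu, hTv, hu'r, hv'r, ?_⟩
    rw [blockForm_three, blockForm_three]
    exact WalkLevel3.reach_trans (by simpa using h₁) (by simpa using h₂)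
  · -- B = [κ, v, u]: tail `[(u,ff),(v,ff),(κ,ff)]` → swap to `[(v′,ff),(u,ff),(κ,ff)]` then caseK
    obtain ⟨v', hTv, hv'r, h₁⟩ := stepLneg (positiveWord A) [(κ, false)] u v hv hur hvr
    have hv' : Central[v'] := by rw [hTv]; exact hv
    obtain ⟨u', v'', hTu, hTv', hu'r, hv''r, h₂⟩ := caseK u v' hu hv' hur hv'r
    refine ⟨u', v'', hTu, hTv'.trans hTv, hu'r, hv''r, ?_⟩
    rw [blockForm_three, blockForm_three]
    exact WalkLevel3.reach_trans (by simpa using h₁) h₂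

/-- **THE DEGENERATE CASE.**  Positive block `{u, v, κ}` and negative block `{u₂, v₂, κ₂}` in any
orders with `u, v, u₂, v₂` central, `T_u = T_{u₂}`, `T_v = T_{v₂}` and equal block monodromies: sort
both blocks by central moves to `[u′, v′, κ] · [u₂′, v₂′, κ₂]‾ʳᵉᵛ`, transport the monodromy equation
and cancel the (equal) central factors: `T_κ = T_{κ₂}`, an honest double. [folklore] -/
theorem degenerate {A B : List PlanarCurve} {u v κ u₂ v₂ κ₂ : PlanarCurve}
    (hA : A = [u, v, κ] ∨ A = [u, κ, v] ∨ A = [v, u, κ] ∨ A = [κ, u, v] ∨ A = [v, κ, u] ∨ A = [κ, v, u])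
    (hB : B = [u₂, v₂, κ₂] ∨ B = [u₂, κ₂, v₂] ∨ B = [v₂, u₂, κ₂] ∨ B = [κ₂, u₂, v₂] ∨ B = [v₂, κ₂, u₂] ∨
      B = [κ₂, v₂, u₂])
    (hu : Central[u]) (hv : Central[v]) (hu₂ : Central[u₂]) (hv₂ : Central[v₂])
    (huu : T 3 (u, true) = T 3 (u₂, true)) (hvv : T 3 (v, true) = T 3 (v₂, true))
    (hur : u.InRange 3) (hvr : v.InRange 3) (hκr : κ.InRange 3)
    (hu₂r : u₂.InRange 3) (hv₂r : v₂.InRange 3) (hκ₂r : κ₂.InRange 3)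
    (hmon : monodromy 3 (positiveWord A) = monodromy 3 (positiveWord B)) :
    ∃ A' B' : List PlanarCurve, Reachable (3, blockForm A B) (3, blockForm A' B') ∧ TwistEq 3 A' B' := by
  obtain ⟨u', v', hTu, hTv, hu'r, hv'r, h₁⟩ :=
    degen_pos hA hu hv hur hvr hκr ((B.map fun c => (c, false)).reverse)
  have h₁' : Reachable (3, blockForm A B) (3, blockForm [u', v', κ] B) := h₁
  obtain ⟨u₂', v₂', hTu₂, hTv₂, hu₂'r, hv₂'r, h₂⟩ := degen_neg [u', v', κ] hB hu₂ hv₂ hu₂r hv₂r hκ₂r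
  have hreach : Reachable (3, blockForm A B) (3, blockForm [u', v', κ] [u₂', v₂', κ₂]) :=
    WalkLevel3.reach_trans h₁' h₂
  have hmon' := monodromy_eq_of_reachable hmon hreach
  -- cancel: `T_{u′} T_{v′} T_κ = T_{u₂′} T_{v₂′} T_{κ₂}` with equal first two factors
  have hM : M 3 (positiveWord [u', v', κ]) = M 3 (positiveWord [u₂', v₂', κ₂]) := Units.ext hmon'
  rw [M_three, M_three, hTu, hTv, hTu₂, hTv₂, huu, hvv] at hM
  have hκ : T 3 (κ, true) = T 3 (κ₂, true) := mul_left_cancel hM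
  refine ⟨[u', v', κ], [u₂', v₂', κ₂], hreach, ?_⟩
  exact List.Forall₂.cons (congrArg Units.val (hTu.trans (huu.trans hTu₂.symm)))
    (List.Forall₂.cons (congrArg Units.val (hTv.trans (hvv.trans hTv₂.symm)))
      (List.Forall₂.cons (congrArg Units.val hκ) List.Forall₂.nil))

/-! ## Global conjugation by a half-twist: images of letters -/

/-- The image of an in-range curve under a supported generator is in range. [folklore] -/
theorem inRange_image {p : PGen} (hp : p.below 3 = true) {c : PlanarCurve} (hc : c.InRange 3) :
    (c.image [p]).InRange 3 := by
  obtain ⟨hab, hb, hg⟩ := hc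
  refine ⟨hab, hb, fun q hq => ?_⟩
  simp only [PlanarCurve.image, List.singleton_append, List.mem_cons] at hq
  rcases hq with rfl | hq
  · exact hp
  · exact hg q hq

/-- **Hole types transform by the hole permutation of the conjugating generator.** [folklore] -/
theorem typeVec_image (p : PGen) (c : PlanarCurve) (i : Fin 3) :
    AbArc.typeVec 3 (c.image [p]) i = AbArc.typeVec 3 c ((PGen.data 3 p).perm.symm i) := by
  rw [AbArc.typeVec_apply, AbArc.typeVec_apply]
  have hperm : (evalWord 3 (c.image [p]).g).perm = (PGen.data 3 p).perm * (evalWord 3 c.g).perm := by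
    show (evalWord 3 (p :: c.g)).perm = _
    rw [evalWord_cons, mul_perm]
  have hsymm : (evalWord 3 (c.image [p]).g).perm.symm i = (evalWord 3 c.g).perm.symm ((PGen.data 3 p).perm.symm i) := by
    rw [hperm]; rfl
  rw [hsymm]
  rfl

/-- The half-twists permute the holes by the transposition `(j j+1)`. [folklore] -/
theorem perm_sigma0 (s : Bool) : (PGen.data 3 (sigma 0 s)).perm = Equiv.swap (0 : Fin 3) 1 := by
  cases s <;> rfl

/-- The half-twists permute the holes by the transposition `(j j+1)`. [folklore] -/
theorem perm_sigma1 (s : Bool) : (PGen.data 3 (sigma 1 s)).perm = Equiv.swap (1 : Fin 3) 2 := by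
  cases s <;> rfl

/-- Types after `σ₀^±`: `110 ↦ 110`, `101 ↦ 011`. [folklore] -/
theorem types_sigma0 (s : Bool) {c : PlanarCurve} :
    (AbArc.typeVec 3 c = ![1, 1, 0] → AbArc.typeVec 3 (c.image [sigma 0 s]) = ![1, 1, 0]) ∧
      (AbArc.typeVec 3 c = ![1, 0, 1] → AbArc.typeVec 3 (c.image [sigma 0 s]) = ![0, 1, 1]) := by
  constructor <;> intro h <;> funext i <;> rw [typeVec_image, perm_sigma0, h, Equiv.symm_swap] <;>
    fin_cases i <;> simp [Equiv.swap_apply_def]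

/-- Types after `σ₁^±`: `011 ↦ 011`, `101 ↦ 110`. [folklore] -/
theorem types_sigma1 (s : Bool) {c : PlanarCurve} :
    (AbArc.typeVec 3 c = ![0, 1, 1] → AbArc.typeVec 3 (c.image [sigma 1 s]) = ![0, 1, 1]) ∧
      (AbArc.typeVec 3 c = ![1, 0, 1] → AbArc.typeVec 3 (c.image [sigma 1 s]) = ![1, 1, 0]) := by
  constructor <;> intro h <;> funext i <;> rw [typeVec_image, perm_sigma1, h, Equiv.symm_swap] <;>
    fin_cases i <;> simp [Equiv.swap_apply_def]

/-- **Central letters stay central under a supported generator** (`g T_[j,j] g⁻¹ = T_[πj,πj]`,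
`g T_[0,2] g⁻¹ = T_[0,2]`). [folklore] -/
theorem central_image {p : PGen} (hp : p.below 3 = true) {d : PlanarCurve} (hd : Central[d]) :
    Central[d.image [p]] := by
  have hT : T 3 (d.image [p], true) = U 3 [p] * T 3 (d, true) * (U 3 [p])⁻¹ := T_image [p] d true
  rcases hd with ⟨j, hj⟩ | hj
  · left
    refine ⟨(evalWord 3 [p]).perm j, ?_⟩
    rw [hT, hj, ← U_invWord, ← U_append, ← U_append]
    exact Units.ext (holeTwist_conj [p] j)
  · right
    rw [hT, hj, ← U_invWord, ← U_append, ← U_append]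
    exact Units.ext (outerTwist_conj3 [p] (by simpa using hp))

/-- The twists of images are conjugates: equal twists have equal image twists. [folklore] -/
theorem T_image_eq {g : List PGen} {c d : PlanarCurve} (h : T 3 (c, true) = T 3 (d, true)) :
    T 3 (c.image g, true) = T 3 (d.image g, true) := by
  rw [T_image, T_image, h]

/-- Global conjugation of a block form is the block form of the images. [folklore] -/
theorem blockForm_map_image (g : List PGen) (A B : List PlanarCurve) :
    (blockForm A B).map (fun l => (l.1.image g, l.2)) = blockForm (A.map (PlanarCurve.image g)) (B.map (PlanarCurve.image g)) := by
  simp [blockForm, positiveWord, List.map_reverse, Function.comp_def]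

/-- **One global conjugation move.** [folklore] -/
theorem conj_reach (g : List PGen) (A B : List PlanarCurve) :
    Reachable (3, blockForm A B) (3, blockForm (A.map (PlanarCurve.image g)) (B.map (PlanarCurve.image g))) := by
  rw [← blockForm_map_image]
  exact (Move.conj 3 g (blockForm A B)).reachable

/-- Arrangements are preserved by mapping. [folklore] -/
theorem arrangement_map (f : PlanarCurve → PlanarCurve) {L : List PlanarCurve} {a b c : PlanarCurve}
    (h : (L = [a, b, c] ∨ L = [a, c, b] ∨ L = [b, a, c] ∨ L = [c, a, b] ∨ L = [b, c, a] ∨ L = [c, b, a])) :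
    (L.map f = [f a, f b, f c] ∨ L.map f = [f a, f c, f b] ∨ L.map f = [f b, f a, f c] ∨ L.map f = [f c, f a, f b] ∨ L.map f = [f b, f c, f a] ∨ L.map f = [f c, f b, f a]) := by
  rcases h with rfl | rfl | rfl | rfl | rfl | rfl <;> simp

/-- An arrangement of three letters is a permutation of them. [folklore] -/
theorem perm_of_arrangement {L : List PlanarCurve} {a b c : PlanarCurve} (h : (L = [a, b, c] ∨ L = [a, c, b] ∨ L = [b, a, c] ∨ L = [c, a, b] ∨ L = [b, c, a] ∨ L = [c, b, a])) :
    List.Perm [a, b, c] L := by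
  rcases h with rfl | rfl | rfl | rfl | rfl | rfl
  · exact List.Perm.refl _
  · exact List.Perm.cons a (List.Perm.swap c b [])
  · exact List.Perm.swap b a [c]
  · exact (List.perm_middle (a := c) (l₁ := [a, b]) (l₂ := [])).symm.symm
  · exact (List.rotate_perm [a, b, c] 1).symm
  · exact (List.reverse_perm [a, b, c]).symm

/-- Members of an arrangement are members of the arranged list. [folklore] -/
theorem mem_of_arrangement {L : List PlanarCurve} {a b c : PlanarCurve} (h : (L = [a, b, c] ∨ L = [a, c, b] ∨ L = [b, a, c] ∨ L = [c, a, b] ∨ L = [b, c, a] ∨ L = [c, b, a])) :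
    a ∈ L ∧ b ∈ L ∧ c ∈ L := by
  rcases h with rfl | rfl | rfl | rfl | rfl | rfl <;> simp

/-- `Unimodular` only depends on the letters, not on their order. [folklore] -/
theorem unimodular_of_perm {L L' : List PlanarCurve} (h : List.Perm L L') (hu : Unimodular 3 L) :
    Unimodular 3 L' := by
  unfold Unimodular at hu ⊢
  have : {x | x ∈ L'.map fun c => Abelianization.of (PlanarCurve.cls 3 c)} =
      {x | x ∈ L.map fun c => Abelianization.of (PlanarCurve.cls 3 c)} := by
    ext x; simp only [Set.mem_setOf_eq, List.mem_map]
    constructor <;> rintro ⟨c, hc, rfl⟩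
    · exact ⟨c, h.symm.subset hc, rfl⟩
    · exact ⟨c, h.subset hc, rfl⟩
  rw [this]; exact hu

end Walk3

open ReachMon in
/-- **Registered helper `helper_walk3_conjReach`** (= `Walk3.conj_reach`): a global conjugation is a
move between the block forms of the letterwise images. [folklore] -/
theorem helper_walk3_conjReach (g : List PGen) (A B : List PlanarCurve) : Reachable (3, blockForm A B) (3, blockForm (A.map (PlanarCurve.image g)) (B.map (PlanarCurve.image g))) :=
  Walk3.conj_reach g A B

end Summit.SmoothPoincare4.SmoothPoincare4.Theorems.PlanarAcyclicBisectionRigidity.Sketch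

end
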